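import Mathlib
import HarnessLib

/-!
# Partial derivatives of `C²` functions of two real variables in curried form

Analysis/Calculus support file (everything proved). The 1+1-dimensional evolution equations of the
tree (the Regge–Wheeler channel items of `Summits/FinalStateConjecture`, route PhotonSphereChannels)
are typed for curried functions `ψ : ℝ → ℝ → ℝ` (time first) in the one-variable language:
`deriv (fun τ => ψ τ x) t`, `deriv (ψ t) x`, `iteratedDeriv 2 (fun τ => ψ τ x) t`,
`iteratedDeriv 2 (ψ t) x`, under the joint hypothesis `ContDiff ℝ 2 (Function.uncurry ψ)`.
`exists_partials_of_contDiff_two` is the dictionary to honest partial derivatives: it produces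
jointly continuous `ψt, ψx, ψtt, ψtx, ψxx` with `∂_τ ψ = ψt`, `∂ₓ ψ = ψx`, `∂_τ ψt = ψtt`,
`∂_τ ψx = ψtx = ∂ₓ ψt` (Schwarz/Clairaut, Mathlib's `ContDiffAt.isSymmSndFDerivAt`), `∂ₓ ψx = ψxx`,
and identifies the iterated one-variable derivatives with `ψtt`, `ψxx`. They are the values of
`fderiv ℝ (uncurry ψ)` and `fderiv ℝ (fderiv ℝ (uncurry ψ))` on the coordinate vectors.

Mathlib has all ingredients (`HasFDerivAt.comp_hasDerivAt`, `HasDerivAt.clm_apply`,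
`ContDiff.fderiv_right`, `ContDiffAt.isSymmSndFDerivAt`) but no packaged curried statement.
-/

noncomputable section

namespace Literature.Analysis.Calculus

open Set Filter Topology

section Partials

variable {ψ : ℝ → ℝ → ℝ}

/-- **First- and second-order partials of a `C²` function of two real variables**, in the curried
one-variable language (`deriv`, `iteratedDeriv`) used by the 1+1 wave-equation statements of the
tree: there are jointly continuous `ψt, ψx, ψtt, ψtx, ψxx` with `∂_τ ψ = ψt`, `∂ₓ ψ = ψx`,
`∂_τ ψt = ψtt`, `∂_τ ψx = ψtx = ∂ₓ ψt` (symmetry of second derivatives, `ContDiffAt.isSymmSndFDerivAt`),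
`∂ₓ ψx = ψxx`, and `iteratedDeriv 2 (ψ · x) t = ψtt t x`, `iteratedDeriv 2 (ψ t) x = ψxx t x`.
(They are the values of `fderiv` / `fderiv (fderiv ·)` of `uncurry ψ` on the coordinate vectors.)
[folklore] -/
theorem exists_partials_of_contDiff_two (hψ : ContDiff ℝ 2 (Function.uncurry ψ)) :
    ∃ ψt ψx ψtt ψtx ψxx : ℝ → ℝ → ℝ,
      Continuous (Function.uncurry ψt) ∧ Continuous (Function.uncurry ψx) ∧
      Continuous (Function.uncurry ψtt) ∧ Continuous (Function.uncurry ψtx) ∧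
      Continuous (Function.uncurry ψxx) ∧
      (∀ t x, HasDerivAt (fun τ => ψ τ x) (ψt t x) t) ∧ (∀ t x, HasDerivAt (ψ t) (ψx t x) x) ∧
      (∀ t x, HasDerivAt (fun τ => ψt τ x) (ψtt t x) t) ∧
      (∀ t x, HasDerivAt (fun τ => ψx τ x) (ψtx t x) t) ∧
      (∀ t x, HasDerivAt (ψt t) (ψtx t x) x) ∧ (∀ t x, HasDerivAt (ψx t) (ψxx t x) x) ∧
      (∀ t x, iteratedDeriv 2 (fun τ => ψ τ x) t = ψtt t x) ∧
      (∀ t x, iteratedDeriv 2 (ψ t) x = ψxx t x) := by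
  set f : ℝ × ℝ → ℝ := Function.uncurry ψ with hf
  set D : ℝ × ℝ → (ℝ × ℝ →L[ℝ] ℝ) := fderiv ℝ f with hD
  set D2 : ℝ × ℝ → (ℝ × ℝ →L[ℝ] (ℝ × ℝ →L[ℝ] ℝ)) := fderiv ℝ D with hD2
  have hDc1 : ContDiff ℝ 1 D := hψ.fderiv_right (by norm_num)
  have hfd : Differentiable ℝ f := hψ.differentiable (by norm_num)
  have hDd : Differentiable ℝ D := hDc1.differentiable (by norm_num)
  have hDcont : Continuous D := hDc1.continuous
  have hD2cont : Continuous D2 := hDc1.continuous_fderiv (by norm_num)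
  have hsymm : ∀ p : ℝ × ℝ, ∀ v w : ℝ × ℝ, D2 p v w = D2 p w v := fun p v w =>
    (hψ.contDiffAt.isSymmSndFDerivAt (by simp)) v w
  -- the curves `τ ↦ (τ, x)` and `y ↦ (t, y)`
  have cτ : ∀ t x : ℝ, HasDerivAt (fun τ : ℝ => (τ, x)) ((1 : ℝ), (0 : ℝ)) t := fun t x =>
    (hasDerivAt_id t).prodMk (hasDerivAt_const t x)
  have cy : ∀ t x : ℝ, HasDerivAt (fun y : ℝ => (t, y)) ((0 : ℝ), (1 : ℝ)) x := fun t x =>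
    (hasDerivAt_const x t).prodMk (hasDerivAt_id x)
  refine ⟨fun t x => D (t, x) (1, 0), fun t x => D (t, x) (0, 1), fun t x => D2 (t, x) (1, 0) (1, 0),
    fun t x => D2 (t, x) (1, 0) (0, 1), fun t x => D2 (t, x) (0, 1) (0, 1),
    ?_, ?_, ?_, ?_, ?_, ?_, ?_, ?_, ?_, ?_, ?_, ?_, ?_⟩
  · exact (hDcont.clm_apply continuous_const : Continuous fun p : ℝ × ℝ => D p (1, 0))
  · exact (hDcont.clm_apply continuous_const : Continuous fun p : ℝ × ℝ => D p (0, 1))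
  · exact ((hD2cont.clm_apply continuous_const).clm_apply continuous_const :
      Continuous fun p : ℝ × ℝ => D2 p (1, 0) (1, 0))
  · exact ((hD2cont.clm_apply continuous_const).clm_apply continuous_const :
      Continuous fun p : ℝ × ℝ => D2 p (1, 0) (0, 1))
  · exact ((hD2cont.clm_apply continuous_const).clm_apply continuous_const :
      Continuous fun p : ℝ × ℝ => D2 p (0, 1) (0, 1))
  · intro t x
    have h := (hfd (t, x)).hasFDerivAt.comp_hasDerivAt t (cτ t x)
    exact h
  · intro t x
    have h := (hfd (t, x)).hasFDerivAt.comp_hasDerivAt x (cy t x)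
    exact h
  · intro t x
    have hc : HasDerivAt (fun τ : ℝ => D (τ, x)) (D2 (t, x) (1, 0)) t :=
      (hDd (t, x)).hasFDerivAt.comp_hasDerivAt t (cτ t x)
    have h := hc.clm_apply (hasDerivAt_const t ((1 : ℝ), (0 : ℝ)))
    simpa using h
  · intro t x
    have hc : HasDerivAt (fun τ : ℝ => D (τ, x)) (D2 (t, x) (1, 0)) t :=
      (hDd (t, x)).hasFDerivAt.comp_hasDerivAt t (cτ t x)
    have h := hc.clm_apply (hasDerivAt_const t ((0 : ℝ), (1 : ℝ)))
    simpa using h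
  · intro t x
    have hc : HasDerivAt (fun y : ℝ => D (t, y)) (D2 (t, x) (0, 1)) x :=
      (hDd (t, x)).hasFDerivAt.comp_hasDerivAt x (cy t x)
    have h := hc.clm_apply (hasDerivAt_const x ((1 : ℝ), (0 : ℝ)))
    rw [hsymm] at h
    simpa using h
  · intro t x
    have hc : HasDerivAt (fun y : ℝ => D (t, y)) (D2 (t, x) (0, 1)) x :=
      (hDd (t, x)).hasFDerivAt.comp_hasDerivAt x (cy t x)
    have h := hc.clm_apply (hasDerivAt_const x ((0 : ℝ), (1 : ℝ)))
    simpa using h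
  · intro t x
    have hfirst : deriv (fun τ => ψ τ x) = fun τ => D (τ, x) (1, 0) := by
      funext τ
      exact ((hfd (τ, x)).hasFDerivAt.comp_hasDerivAt τ (cτ τ x)).deriv
    rw [iteratedDeriv_succ, iteratedDeriv_one, hfirst]
    have hc : HasDerivAt (fun τ : ℝ => D (τ, x)) (D2 (t, x) (1, 0)) t :=
      (hDd (t, x)).hasFDerivAt.comp_hasDerivAt t (cτ t x)
    have h := hc.clm_apply (hasDerivAt_const t ((1 : ℝ), (0 : ℝ)))
    simpa using h.deriv
  · intro t x
    have hfirst : deriv (ψ t) = fun y => D (t, y) (0, 1) := by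
      funext y
      exact ((hfd (t, y)).hasFDerivAt.comp_hasDerivAt y (cy t y)).deriv
    rw [iteratedDeriv_succ, iteratedDeriv_one, hfirst]
    have hc : HasDerivAt (fun y : ℝ => D (t, y)) (D2 (t, x) (0, 1)) x :=
      (hDd (t, x)).hasFDerivAt.comp_hasDerivAt x (cy t x)
    have h := hc.clm_apply (hasDerivAt_const x ((0 : ℝ), (1 : ℝ)))
    simpa using h.deriv

end Partials


end Literature.Analysis.Calculus
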